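import Literature.NumberTheory.NumberFields.HilbertClassFieldCorrespondence
import Mathlib.GroupTheory.Perm.Cycle.Type
import Mathlib.RingTheory.RootsOfUnity.Complex
import HarnessLib

/-!
# `p ∣ h_K` iff `K` has an abelian extension of degree `p` unramified at all places
# (Cox Cor. 5.24 with Cauchy's theorem in `Cl(𝓞 K)`)

Topic `NumberTheory/NumberFields` (class field theory); namespace
`Literature.NumberTheory.NumberFields.hilbertClassField`.  Theorem-only file (no definition, no named
fact), unconditional; sequel of `HilbertClassFieldCorrespondence.lean` (the class field
`classFieldOfSubgroup K S` of a subgroup `S ≤ Cl(𝓞 K)`: abelian, unramified at all places, of degree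
`[Cl(𝓞 K) : S]`) and `HilbertClassFieldMaximal.lean` (`[L : K] ∣ h_K` for every finite abelian `L ⊆ K̄`
unramified at all places).

> Cox, *Primes of the form x² + ny²* (2nd ed.), §5.C Cor. 5.24 (unramified Abelian extensions ↔
> subgroups of `C(𝒪_K)`, `Gal(M/K) ≅ C(𝒪_K)/H`); applied with a subgroup of prime index `p`, which exists
> iff `p ∣ h(𝒪_K)` (Cauchy).  This is the form in which the Hilbert class field enters class number
> divisibility questions ("`K` has an unramified cyclic extension of degree `p` iff `p ∣ h_K`", e.g.
> Washington, *Cyclotomic Fields*, Thm. 10.1 ff.).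

## Main results (`K : Type` a number field, `p` a prime)

* `exists_subgroup_index_eq_of_prime_dvd_card` — a finite abelian group of order divisible by `p` has a
  subgroup of index `p` (the kernel of a character of order `p`; Cauchy in the dual group).
* **`exists_abelian_unramified_finrank_eq_of_prime_dvd`** — if `p ∣ h_K` there is a finite abelian
  `L ⊆ K̄`, unramified at every finite prime and at the infinite places, with `[L : K] = p`.
* **`prime_dvd_card_classGroup_iff`** — `p ∣ h_K` iff such an `L` exists.

## References

* D. A. Cox, *Primes of the form x² + ny²*, 2nd ed. (2013), §5.C Cor. 5.24. [Cox2013]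
* J. Neukirch, *Algebraic Number Theory* (1999), Ch. VI §6 Prop. (6.9). [NeukirchANT1999]
-/

noncomputable section

open NumberField IsDedekindDomain Field
open scoped nonZeroDivisors

namespace Literature.NumberTheory.NumberFields

namespace hilbertClassField

/-! ### §1. Subgroups of prime index in a finite abelian group -/

/-- **A finite abelian group whose order is divisible by the prime `p` has a subgroup of index `p`**:
by duality `|Hom(G, ℂˣ)| = |G|`, so (Cauchy) there is a character `χ` of order `p`; its image is a
nontrivial subgroup of the `p`-th roots of unity, hence of order `p`, and `ker χ` has index `p`.
[folklore] -/
private theorem exists_subgroup_index_eq_of_prime_dvd_card {G : Type*} [CommGroup G] [Finite G] {p : ℕ}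
    (hp : p.Prime) (hdvd : p ∣ Nat.card G) : ∃ S : Subgroup G, S.index = p := by
  classical
  haveI : Fact p.Prime := ⟨hp⟩
  haveI : NeZero p := ⟨hp.ne_zero⟩
  haveI : NeZero ((Monoid.exponent G : ℕ) : ℂ) := ⟨Nat.cast_ne_zero.mpr Monoid.exponent_ne_zero_of_finite⟩
  haveI : HasEnoughRootsOfUnity ℂ (Monoid.exponent G) := inferInstance
  have hcard : Nat.card (G →* ℂˣ) = Nat.card G := CommGroup.card_monoidHom_of_hasEnoughRootsOfUnity G ℂ
  haveI : Finite (G →* ℂˣ) := Nat.finite_of_card_ne_zero (by rw [hcard]; exact Nat.card_pos.ne')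
  haveI : Fintype (G →* ℂˣ) := Fintype.ofFinite _
  have hdvd' : p ∣ Fintype.card (G →* ℂˣ) := by rwa [← Nat.card_eq_fintype_card, hcard]
  obtain ⟨χ, hχ⟩ := exists_prime_orderOf_dvd_card p hdvd'
  refine ⟨χ.ker, ?_⟩
  rw [Subgroup.index_ker]
  -- `range χ ≤ μ_p`, a group of order `p`, and `range χ ≠ 1`
  have hle : χ.range ≤ rootsOfUnity p ℂ := by
    rintro _ ⟨g, rfl⟩
    rw [mem_rootsOfUnity, ← MonoidHom.pow_apply, ← hχ, pow_orderOf_eq_one, MonoidHom.one_apply]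
  have hdvdp : Nat.card χ.range ∣ p := by
    have h := Subgroup.card_dvd_of_le hle
    rwa [Complex.card_rootsOfUnity] at h
  rcases (Nat.dvd_prime hp).mp hdvdp with h1 | hpp
  · exfalso
    have hbot : χ.range = ⊥ := Subgroup.eq_bot_of_card_eq χ.range h1
    have hχ1 : χ = 1 := by
      ext g
      have : χ g ∈ χ.range := ⟨g, rfl⟩
      rw [hbot, Subgroup.mem_bot] at this
      rw [this, MonoidHom.one_apply]
    rw [hχ1, orderOf_one] at hχ
    exact hp.one_lt.ne hχ
  · exact hpp

/-! ### §2. Unramified abelian extensions of prime degree -/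

variable (K : Type) [Field K] [NumberField K]

/-- **If the prime `p` divides `h_K`, then `K` has an abelian extension of degree `p` inside `K̄`,
unramified at every finite prime and at the infinite places** (the class field of a subgroup of index
`p` of `Cl(𝓞 K)`). [cite: Cox2013, §5.C Cor. 5.24] [cite: NeukirchANT1999, Ch. VI §6 Prop. (6.9)] -/
theorem exists_abelian_unramified_finrank_eq_of_prime_dvd {p : ℕ} (hp : p.Prime)
    (hdvd : p ∣ Fintype.card (ClassGroup (𝓞 K))) :
    ∃ (L : IntermediateField K (AlgebraicClosure K)) (_ : FiniteDimensional K L) (_ : IsAbelianGalois K L)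
      (_ : NumberField L) (_ : IsUnramifiedAtInfinitePlaces K L),
      (∀ v : HeightOneSpectrum (𝓞 K), Algebra.IsUnramifiedIn (𝓞 L) v.asIdeal) ∧ Module.finrank K L = p := by
  rw [← Nat.card_eq_fintype_card] at hdvd
  obtain ⟨S, hS⟩ := exists_subgroup_index_eq_of_prime_dvd_card hp hdvd
  exact ⟨classFieldOfSubgroup K S, inferInstance, inferInstance, inferInstance, inferInstance,
    classFieldOfSubgroup_isUnramifiedIn K S, by rw [finrank_classFieldOfSubgroup, hS]⟩

/-- **`p ∣ h_K` iff `K` has an abelian extension of degree `p` inside `K̄` unramified at all places**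
(`⇐`: `[L : K] ∣ h_K`, `finrank_dvd_classNumber_of_abelian`). [cite: Cox2013, §5.C Cor. 5.24]
[cite: NeukirchANT1999, Ch. VI §6 Prop. (6.9)] -/
theorem prime_dvd_card_classGroup_iff {p : ℕ} (hp : p.Prime) :
    p ∣ Fintype.card (ClassGroup (𝓞 K)) ↔
      ∃ (L : IntermediateField K (AlgebraicClosure K)) (_ : FiniteDimensional K L) (_ : IsAbelianGalois K L)
        (_ : NumberField L) (_ : IsUnramifiedAtInfinitePlaces K L),
        (∀ v : HeightOneSpectrum (𝓞 K), Algebra.IsUnramifiedIn (𝓞 L) v.asIdeal) ∧ Module.finrank K L = p := by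
  constructor
  · exact exists_abelian_unramified_finrank_eq_of_prime_dvd K hp
  · rintro ⟨L, _, _, _, _, hunr, hdeg⟩
    rw [← hdeg]
    exact finrank_dvd_classNumber_of_abelian K L hunr

/-- The same with `classNumber K`. [cite: Cox2013, §5.C Cor. 5.24] -/
theorem prime_dvd_classNumber_iff {p : ℕ} (hp : p.Prime) :
    p ∣ NumberField.classNumber K ↔
      ∃ (L : IntermediateField K (AlgebraicClosure K)) (_ : FiniteDimensional K L) (_ : IsAbelianGalois K L)
        (_ : NumberField L) (_ : IsUnramifiedAtInfinitePlaces K L),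
        (∀ v : HeightOneSpectrum (𝓞 K), Algebra.IsUnramifiedIn (𝓞 L) v.asIdeal) ∧ Module.finrank K L = p :=
  prime_dvd_card_classGroup_iff K hp

end hilbertClassField

end Literature.NumberTheory.NumberFields

end
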